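import Literature.NumberTheory.Weil1964.AdelicChirpIntegralDilation
import Literature.NumberTheory.Automorphic.AdelicThetaTailRayDecay
import Literature.NumberTheory.Automorphic.AdelicVectorHeight
import HarnessLib

/-!
# The narrow-ray bound of Weil's boundedness theorem (Siegel–Weil, rank one), abstract form

[Weil1965] n° 48 (Lemmes 21, 23) and n° 50 (proof of Thm. 4), in the Hodge-CM cell's sheet
`SW2c-BOUND-ASSEMBLY.v0` §3 (B): a functional `E` on `𝒮(𝔸_F^m)` split as `‖EΦ‖ ≤ ‖E_I Φ‖ + κ‖E_E Φ‖` into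
* a THETA-TYPE part `E_I`, controlled by tail sums over non-zero rational vectors:
  `‖E_I Φ‖ ≤ c_I · sup_{h ∈ Ω} Σ_{ξ ≠ 0} |Φ(ξ L_h)|` (the positive measure `Î = Σ_b μ̂_b` of the doubled theta
  integral, `L_h` ranging over a compact fundamental set), and
* an EISENSTEIN-TYPE part `E_E`, controlled Fourier-side: `‖E_E Φ‖ ≤ Σ_{ξ ∈ F} |F*_Φ(ξ)|`,
  `F*_Φ(η) = ∫ chirp(η • S) Φ` (Weil's `E_X = Σ_b μ_b = Σ_ξ F*_Φ(ξ)` by Poisson),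
is bounded on the NARROW RAY of Borel translates `chirp(β • S) ∘ twist(a · z(r)⁻¹)` (`β` in a compact set,
`a` in a compact set `A` of similitudes of `S`, `z(r) = posRealScalar`, `0 < r ≤ 1`) UNIFORMLY over a
family `𝔉` of test functions with common decay data, by `M_B · r^{m[F:ℚ]/2}` — the square root of the
`L²`-modulus `|det(a z(r)⁻¹)⁻¹|_𝔸 ≍ r^{m[F:ℚ]}` of the twist, as the normalised target (**)′ requires:
* theta side (§2): the tail is `O(r^θ)` for every `θ ≤ k` (★ `AdelicThetaTailRayDecay`), uniformly over `𝔉`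
  and over `L_h · a` with finite parts in a compact set and bounded archimedean height;
* Eisenstein side (§1, §3): `F*_{chirp(βS) twist(g) Φ}(ξ) = |det g⁻¹|_𝔸 · F*_Φ((ξ + β) · u_a · z(r)²)`
  (★ `integral_chirp_twist`, similitude `a⁻¹ S a⁻ᵀ = u_a • S`), the adelic Gauss majorant
  `|F*_Φ(η)| ≤ A₁ h(1, η)^{−N}` (hypothesis (E1)) and the sharp count
  `s^{[F:ℚ]} Σ_ξ h(1, (ξ+β) u z(s))^{−N} ≤ C₃` (hypothesis (E3′)) give `O(r^{(m−2)[F:ℚ]})`;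
* §4 `exists_narrowRay_bound`: both are `≤ M_B r^{m[F:ℚ]/2}` for `r ≤ 1` as soon as `m ≥ 4`
  (rank-one Siegel–Weil: `m = 2N`, `N ≥ 2` — Weil's convergent range enters through (E3′), `N > 2`).
All analytic inputs are hypotheses in the shapes of the sheet; no reduction theory, no measure is
constructed here.  Cell `hodgecm-mathlib`, FLOOR 0, E-2 desk, crux H413 (stmt-HodgeConjecture-24833),
row SW2c-BOUND (B); HC_CM is proved only modulo the printed citations until rung 0 closes.

## References
* [Weil1965] A. Weil, *Sur la formule de Siegel dans la théorie des groupes classiques*, Acta Math. 113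
  (1965), n° 48 (Lemmes 21–23), n° 50 (Thm. 4).
* [GodementJacquetLNM260] R. Godement, H. Jacquet, *Zeta functions of simple algebras*, LNM 260, §11.
-/

set_option autoImplicit false

noncomputable section

open scoped NNReal ENNReal Matrix Classical
open NumberField IsDedekindDomain MeasureTheory Matrix

namespace Literature.NumberTheory.Weil1964

open Literature.NumberTheory.Automorphic Literature.RepresentationTheory.HeisenbergGroup

variable (F : Type) [Field F] [NumberField F] {m : ℕ}
variable [MeasurableSpace (AdeleRing (𝓞 F) F)] [BorelSpace (AdeleRing (𝓞 F) F)]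
variable (ν : Measure (Fin m → AdeleRing (𝓞 F) F)) [ν.IsAddHaarMeasure]

/-! ## §1 Eisenstein-side algebra: chirp shifts and twists inside the Gauss transform -/

omit [BorelSpace (AdeleRing (𝓞 F) F)] [ν.IsAddHaarMeasure] in
/-- `F*_{chirp(β•S)Φ}(η) = F*_Φ(η + β)`: a chirp shifts the Fourier variable of the Gauss transform. [cite: Weil1965, n° 41] -/
theorem integral_chirp_smul_chirp_smul (η β : AdeleRing (𝓞 F) F) (S : Matrix (Fin m) (Fin m) (AdeleRing (𝓞 F) F))
    (Φ : (Fin m → AdeleRing (𝓞 F) F) → ℂ) :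
    ∫ x, chirp F (η • S) (chirp F (β • S) Φ) x ∂ν = ∫ x, chirp F ((η + β) • S) Φ x ∂ν := by
  rw [add_smul, chirp_add_matrix]

/-- `F*_{twist(g)Φ}(η) = |det g⁻¹|_𝔸 · ∫ chirp(η • (g⁻¹ S g⁻ᵀ)) Φ` (★ `integral_chirp_twist`). [cite: Weil1965, n° 48] -/
theorem integral_chirp_smul_twist (η : AdeleRing (𝓞 F) F) (S : Matrix (Fin m) (Fin m) (AdeleRing (𝓞 F) F))
    (g : GL (Fin m) (AdeleRing (𝓞 F) F)) (Φ : (Fin m → AdeleRing (𝓞 F) F) → ℂ) :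
    ∫ x, chirp F (η • S) (twist F g Φ) x ∂ν =
      ((adelicAbsDet m F g⁻¹ : ℝ≥0) : ℝ) •
        ∫ x, chirp F (η • (((g⁻¹ : GL (Fin m) (AdeleRing (𝓞 F) F)) : Matrix (Fin m) (Fin m) (AdeleRing (𝓞 F) F)) * S *
          (((g⁻¹ : GL (Fin m) (AdeleRing (𝓞 F) F)) : Matrix (Fin m) (Fin m) (AdeleRing (𝓞 F) F)))ᵀ)) Φ x ∂ν := by
  rw [integral_chirp_twist, Matrix.mul_smul, Matrix.smul_mul]

/-! ## §2 The archimedean ray `z(r) = posRealScalar m F r` inside a twist -/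

omit [MeasurableSpace (AdeleRing (𝓞 F) F)] [BorelSpace (AdeleRing (𝓞 F) F)] in
/-- The matrix of `z(r)` is the scalar matrix `ρ_r • 1`, `ρ_r = posRealIdele F r`. [folklore] -/
private theorem coe_posRealScalar_eq_smul_one (r : ℝ≥0ˣ) :
    ((posRealScalar m F r : GL (Fin m) (AdeleRing (𝓞 F) F)) : Matrix (Fin m) (Fin m) (AdeleRing (𝓞 F) F)) =
      ((posRealIdele F r : (AdeleRing (𝓞 F) F)ˣ) : AdeleRing (𝓞 F) F) • (1 : Matrix (Fin m) (Fin m) (AdeleRing (𝓞 F) F)) := by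
  ext i j
  change Matrix.diagonal (fun _ => ((posRealIdele F r : (AdeleRing (𝓞 F) F)ˣ) : AdeleRing (𝓞 F) F)) i j = _
  rw [Matrix.smul_apply, Matrix.one_apply, Matrix.diagonal_apply, smul_eq_mul, mul_ite, mul_one, mul_zero]

omit [MeasurableSpace (AdeleRing (𝓞 F) F)] [BorelSpace (AdeleRing (𝓞 F) F)] in
/-- **`(a z(r)⁻¹)⁻¹ S (a z(r)⁻¹)⁻ᵀ = ρ_{r²} • (a⁻¹ S a⁻ᵀ)`**: along the ray the conjugated form is rescaled by the
positive real idele `ρ_{r²} = posRealIdele F (r²) = ρ_r²`. [cite: Weil1965, n° 48] -/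
theorem inv_mul_mul_inv_transpose_ray (a : GL (Fin m) (AdeleRing (𝓞 F) F)) (r : ℝ≥0ˣ)
    (S : Matrix (Fin m) (Fin m) (AdeleRing (𝓞 F) F)) :
    (((a * (posRealScalar m F r)⁻¹)⁻¹ : GL (Fin m) (AdeleRing (𝓞 F) F)) : Matrix (Fin m) (Fin m) (AdeleRing (𝓞 F) F)) * S *
        ((((a * (posRealScalar m F r)⁻¹)⁻¹ : GL (Fin m) (AdeleRing (𝓞 F) F)) :
          Matrix (Fin m) (Fin m) (AdeleRing (𝓞 F) F)))ᵀ =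
      ((posRealIdele F (r ^ 2) : (AdeleRing (𝓞 F) F)ˣ) : AdeleRing (𝓞 F) F) •
        (((a⁻¹ : GL (Fin m) (AdeleRing (𝓞 F) F)) : Matrix (Fin m) (Fin m) (AdeleRing (𝓞 F) F)) * S *
          (((a⁻¹ : GL (Fin m) (AdeleRing (𝓞 F) F)) : Matrix (Fin m) (Fin m) (AdeleRing (𝓞 F) F)))ᵀ) := by
  have hinv : ((a * (posRealScalar m F r)⁻¹)⁻¹ : GL (Fin m) (AdeleRing (𝓞 F) F)) = posRealScalar m F r * a⁻¹ := by
    rw [_root_.mul_inv_rev, inv_inv]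
  rw [map_pow, Units.val_pow_eq_pow_val, hinv, Units.val_mul, coe_posRealScalar_eq_smul_one]
  simp only [Matrix.transpose_smul, Matrix.smul_mul, Matrix.mul_smul, Matrix.one_mul, smul_smul, sq]

omit [MeasurableSpace (AdeleRing (𝓞 F) F)] [BorelSpace (AdeleRing (𝓞 F) F)] in
/-- `|det z(r)|_𝔸 = r^{m [F:ℚ]}` (the module of the real scalar `z(r)` on `𝔸_F^m`). [cite: WeilBNT1967, Ch. IV §3 Cor. 1] -/
theorem adelicAbsDet_posRealScalar (r : ℝ≥0ˣ) :
    adelicAbsDet m F (posRealScalar m F r) = ((r : ℝ≥0) ^ Module.finrank ℚ F) ^ m := by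
  change adelicAbsDet m F (Matrix.GeneralLinearGroup.scalar (Fin m) (posRealIdele F r)) = _
  rw [adelicAbsDet_scalar, ideleNorm_posRealIdele_holds]

omit [MeasurableSpace (AdeleRing (𝓞 F) F)] [BorelSpace (AdeleRing (𝓞 F) F)] in
/-- `|det (a z(r)⁻¹)⁻¹|_𝔸 = r^{m[F:ℚ]} · |det a|_𝔸⁻¹`. [cite: WeilBNT1967, Ch. IV §3 Cor. 1] -/
theorem adelicAbsDet_inv_ray (a : GL (Fin m) (AdeleRing (𝓞 F) F)) (r : ℝ≥0ˣ) :
    adelicAbsDet m F (a * (posRealScalar m F r)⁻¹)⁻¹ = ((r : ℝ≥0) ^ Module.finrank ℚ F) ^ m * (adelicAbsDet m F a)⁻¹ := by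
  rw [_root_.mul_inv_rev, inv_inv, map_mul, map_inv, adelicAbsDet_posRealScalar]

/-! ## §3 The Eisenstein-side term along the narrow ray -/

/-- **The `ξ`-th Eisenstein-side term of the Borel translate**: for a similitude `a` (`a⁻¹ S a⁻ᵀ = u • S`),
`F*_{chirp(β•S) twist(a z(r)⁻¹) Φ}(η) = (r^{m[F:ℚ]} |det a|⁻¹) · F*_Φ((η + β) u ρ_{r²})`. [cite: Weil1965, n° 48] -/
theorem integral_chirp_smul_borelTranslate (η β : AdeleRing (𝓞 F) F) (S : Matrix (Fin m) (Fin m) (AdeleRing (𝓞 F) F))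
    (a : GL (Fin m) (AdeleRing (𝓞 F) F)) {u : AdeleRing (𝓞 F) F}
    (hsim : ((a⁻¹ : GL (Fin m) (AdeleRing (𝓞 F) F)) : Matrix (Fin m) (Fin m) (AdeleRing (𝓞 F) F)) * S *
      (((a⁻¹ : GL (Fin m) (AdeleRing (𝓞 F) F)) : Matrix (Fin m) (Fin m) (AdeleRing (𝓞 F) F)))ᵀ = u • S)
    (r : ℝ≥0ˣ) (Φ : (Fin m → AdeleRing (𝓞 F) F) → ℂ) :
    ∫ x, chirp F (η • S) (chirp F (β • S) (twist F (a * (posRealScalar m F r)⁻¹) Φ)) x ∂ν =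
      (((((r : ℝ≥0) ^ Module.finrank ℚ F) ^ m * (adelicAbsDet m F a)⁻¹ : ℝ≥0)) : ℝ) •
        ∫ x, chirp F (((η + β) * u * ((posRealIdele F (r ^ 2) : (AdeleRing (𝓞 F) F)ˣ) : AdeleRing (𝓞 F) F)) • S) Φ x ∂ν := by
  rw [integral_chirp_smul_chirp_smul, integral_chirp_smul_twist, inv_mul_mul_inv_transpose_ray, hsim,
    adelicAbsDet_inv_ray, smul_smul, smul_smul, mul_right_comm]

/-! ## §4 The theta tail along the ray, uniformly over a family with common decay data -/

omit [MeasurableSpace (AdeleRing (𝓞 F) F)] [BorelSpace (AdeleRing (𝓞 F) F)] in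
/-- ★ `exists_tsum_enorm_vecMul_tail_ray_le_archHeight_rpow` with the test function quantified INSIDE: one
constant `B` serves every `Ψ` with the decay data `(M, k, C_f)`. [cite: GodementJacquetLNM260, §11; Weil1965, n° 48 Lemme 21] -/
theorem exists_tsum_enorm_vecMul_tail_ray_le_uniform {k : ℕ} {M : ℝ} (hM0 : 0 ≤ M)
    {Cf : Set (Fin m → FiniteAdeleRing (𝓞 F) F)} (hCfc : IsCompact Cf)
    {𝒴 : Set (GL (Fin m) (FiniteAdeleRing (𝓞 F) F))} (h𝒴 : IsCompact 𝒴)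
    {θ : ℝ} (hθ : (m : ℝ) * Module.finrank ℚ F < θ) (hθk : θ ≤ k) :
    ∃ B : ℝ≥0∞, B ≠ ⊤ ∧ ∀ Ψ : (Fin m → AdeleRing (𝓞 F) F) → ℂ,
      (∀ x, ‖Ψ x‖ ≤ M * (1 + ‖vecInfinitePart F m x‖) ^ (-(k : ℝ))) →
      (∀ x, vecFinitePart F m x ∉ Cf → Ψ x = 0) →
      ∀ L : GL (Fin m) (AdeleRing (𝓞 F) F), GLn.sndHom m F L ∈ 𝒴 → ∀ r : ℝ≥0ˣ,
        ∑' v : ↥{v : Fin m → F | v ≠ 0},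
            (‖Ψ (ratVec F (v : Fin m → F) ᵥ*
              ((L * (posRealScalar m F r)⁻¹ : GL (Fin m) (AdeleRing (𝓞 F) F)) :
                Matrix (Fin m) (Fin m) (AdeleRing (𝓞 F) F)))‖ₑ : ℝ≥0∞) ≤
          ENNReal.ofReal (((r : ℝ≥0) : ℝ) ^ θ) *
            (B * ENNReal.ofReal ((max 1 ((m : ℝ) ^ 2 * (GLn.archHeight m F L : ℝ))) ^ θ)) := by
  have hθ0 : 0 ≤ θ := le_trans (by positivity) hθ.le
  obtain ⟨C', hC'c, hC'⟩ := exists_isCompact_vecFinitePart_mem F hCfc h𝒴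
  set Z : ℝ≥0∞ := ∑' v : ↥{v : Fin m → F | v ≠ 0 ∧ vecFinitePart F m (ratVec F v) ∈ C'},
    ENNReal.ofReal (‖vecInfinitePart F m (ratVec F (v : Fin m → F))‖ ^ (-θ)) with hZ
  have hZtop : Z < ⊤ := by
    have h := tsum_norm_vecInfinitePart_rpow_neg_lt_top F (n := m) (1 : GL (Fin m) (AdeleRing (𝓞 F) F)) hC'c hθ
    have hS : {v : Fin m → F | v ≠ 0 ∧ vecFinitePart F m (ratVec F v ᵥ*
        ((1 : GL (Fin m) (AdeleRing (𝓞 F) F)) : Matrix (Fin m) (Fin m) (AdeleRing (𝓞 F) F))) ∈ C'} =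
        {v : Fin m → F | v ≠ 0 ∧ vecFinitePart F m (ratVec F v) ∈ C'} := by
      ext v
      simp only [Matrix.GeneralLinearGroup.coe_one, Matrix.vecMul_one, Set.mem_setOf_eq]
    rw [hZ, ← tsum_congr_set_coe (fun v : Fin m → F =>
      ENNReal.ofReal (‖vecInfinitePart F m (ratVec F v)‖ ^ (-θ))) hS]
    simpa only [Matrix.GeneralLinearGroup.coe_one, Matrix.vecMul_one] using h
  refine ⟨ENNReal.ofReal M * Z, ENNReal.mul_ne_top ENNReal.ofReal_ne_top hZtop.ne, fun Ψ hM hCf L hL r => ?_⟩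
  set G : ℝ := max 1 ((m : ℝ) ^ 2 * (GLn.archHeight m F L : ℝ)) with hG
  have hG1 : 1 ≤ G := le_max_left _ _
  have hG0 : 0 < G := one_pos.trans_le hG1
  have hGL := (sum_norm_inv_arch_le_mul_archHeight F L).trans (le_max_right 1 _)
  have hmain := tsum_enorm_vecMul_tail_ray_le F hM0 hM hCf L (hC' L hL) hG0 hGL hθ0 hθk r
  refine hmain.trans (le_of_eq ?_)
  have hGθ : G⁻¹ ^ (-θ) = G ^ θ := by
    rw [Real.inv_rpow hG0.le, ← Real.rpow_neg hG0.le, neg_neg]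
  rw [hGθ, ENNReal.ofReal_mul hM0, mul_assoc, mul_assoc, mul_comm (ENNReal.ofReal (G ^ θ)) Z]

/-! ## §5 The narrow-ray bound -/

omit [MeasurableSpace (AdeleRing (𝓞 F) F)] [BorelSpace (AdeleRing (𝓞 F) F)] in
/-- Pointwise modulus of a Borel translate: `|(chirp(β•S) twist(g) Φ)(x)| = |Φ(x g)|`. [folklore] -/
private theorem enorm_chirpLM_twistLM_apply (β : AdeleRing (𝓞 F) F) (S : Matrix (Fin m) (Fin m) (AdeleRing (𝓞 F) F))
    (g : GL (Fin m) (AdeleRing (𝓞 F) F)) (Φ : piSchwartzBruhat F (Fin m)) (x : Fin m → AdeleRing (𝓞 F) F) :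
    (‖((chirpLM F (β • S) (twistLM F g Φ) : piSchwartzBruhat F (Fin m)) : (Fin m → AdeleRing (𝓞 F) F) → ℂ) x‖ₑ : ℝ≥0∞) =
      ‖(Φ : (Fin m → AdeleRing (𝓞 F) F) → ℂ) (x ᵥ* (g : Matrix (Fin m) (Fin m) (AdeleRing (𝓞 F) F)))‖ₑ := by
  rw [coe_chirpLM, coe_twistLM, chirp_apply, twist_apply, enorm_mul, ← ofReal_norm, norm_sdChar, ENNReal.ofReal_one,
    one_mul]

/-- **THE NARROW-RAY BOUND** (sheet `SW2c-BOUND-ASSEMBLY.v0` §3 (B), abstract form). See the module docstring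
for the meaning of the hypotheses; the conclusion is the `hB`-shape consumed by
★ `SiegelWeilBorelBoundReduction.norm_apply_omega_le_of_forall_reduction` once the Borel translates are identified
with `ω(r₀(·))` by the frame letters (L-N), (L-D). [cite: Weil1965, n° 48 Lemmes 21–23 and n° 50] -/
theorem exists_narrowRay_bound (S : Matrix (Fin m) (Fin m) (AdeleRing (𝓞 F) F))
    (E EI EE : piSchwartzBruhat F (Fin m) →ₗ[ℂ] ℂ) (κ : ℝ≥0∞) (hκ : κ ≠ ⊤)
    (hsplit : ∀ Φ : piSchwartzBruhat F (Fin m), (‖E Φ‖ₑ : ℝ≥0∞) ≤ ‖EI Φ‖ₑ + κ * ‖EE Φ‖ₑ)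
    -- theta-type part
    {ι : Type*} (Ω : Set ι) (L : ι → GL (Fin m) (AdeleRing (𝓞 F) F)) (cI : ℝ≥0∞) (hcI : cI ≠ ⊤)
    (hI : ∀ (Φ : piSchwartzBruhat F (Fin m)) (B : ℝ≥0∞),
      (∀ h ∈ Ω, ∑' v : ↥{v : Fin m → F | v ≠ 0},
        (‖(Φ : (Fin m → AdeleRing (𝓞 F) F) → ℂ) (ratVec F (v : Fin m → F) ᵥ*
          (L h : Matrix (Fin m) (Fin m) (AdeleRing (𝓞 F) F)))‖ₑ : ℝ≥0∞) ≤ B) → (‖EI Φ‖ₑ : ℝ≥0∞) ≤ cI * B)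
    -- Eisenstein-type part (Fourier side)
    (hEE : ∀ Φ : piSchwartzBruhat F (Fin m), (‖EE Φ‖ₑ : ℝ≥0∞) ≤
      ∑' ξ : F, (‖∫ x, chirp F ((algebraMap F (AdeleRing (𝓞 F) F) ξ) • S)
        ((Φ : piSchwartzBruhat F (Fin m)) : (Fin m → AdeleRing (𝓞 F) F) → ℂ) x ∂ν‖ₑ : ℝ≥0∞))
    -- the family of test functions: common decay data and the adelic Gauss majorant (E1)
    (𝔉 : Set (piSchwartzBruhat F (Fin m))) {M : ℝ} {k : ℕ} (hM0 : 0 ≤ M)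
    (hdecay : ∀ Φ ∈ 𝔉, ∀ x, ‖((Φ : piSchwartzBruhat F (Fin m)) : (Fin m → AdeleRing (𝓞 F) F) → ℂ) x‖ ≤
      M * (1 + ‖vecInfinitePart F m x‖) ^ (-(k : ℝ)))
    {Cf : Set (Fin m → FiniteAdeleRing (𝓞 F) F)} (hCfc : IsCompact Cf)
    (hCf : ∀ Φ ∈ 𝔉, ∀ x, vecFinitePart F m x ∉ Cf → ((Φ : piSchwartzBruhat F (Fin m)) : (Fin m → AdeleRing (𝓞 F) F) → ℂ) x = 0)
    {Nexp A₁ : ℝ} (hA₁ : 0 ≤ A₁)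
    (hE1 : ∀ Φ ∈ 𝔉, ∀ η : AdeleRing (𝓞 F) F,
      ‖∫ x, chirp F (η • S) ((Φ : piSchwartzBruhat F (Fin m)) : (Fin m → AdeleRing (𝓞 F) F) → ℂ) x ∂ν‖ ≤
        A₁ * ((vecHeight F (![1, η] : Fin 2 → AdeleRing (𝓞 F) F) : ℝ≥0) : ℝ) ^ (-Nexp))
    -- the base twists: similitudes of `S` with compact finite parts, bounded height and bounded `|det|⁻¹`
    (A : Set (GL (Fin m) (AdeleRing (𝓞 F) F))) (u : GL (Fin m) (AdeleRing (𝓞 F) F) → AdeleRing (𝓞 F) F)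
    (hsim : ∀ a ∈ A, ((a⁻¹ : GL (Fin m) (AdeleRing (𝓞 F) F)) : Matrix (Fin m) (Fin m) (AdeleRing (𝓞 F) F)) * S *
      (((a⁻¹ : GL (Fin m) (AdeleRing (𝓞 F) F)) : Matrix (Fin m) (Fin m) (AdeleRing (𝓞 F) F)))ᵀ = u a • S)
    {𝒴 : Set (GL (Fin m) (FiniteAdeleRing (𝓞 F) F))} (h𝒴 : IsCompact 𝒴) {H₀ : ℝ} {D₀ : ℝ≥0}
    (hLA : ∀ h ∈ Ω, ∀ a ∈ A, GLn.sndHom m F (L h * a) ∈ 𝒴 ∧ (GLn.archHeight m F (L h * a) : ℝ) ≤ H₀)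
    (hdet : ∀ a ∈ A, (adelicAbsDet m F a)⁻¹ ≤ D₀)
    -- the sharp count (E3′)
    (Kβ : Set (AdeleRing (𝓞 F) F)) (C₃ : ℝ≥0∞) (hC₃ : C₃ ≠ ⊤)
    (hE3 : ∀ β ∈ Kβ, ∀ a ∈ A, ∀ s : ℝ≥0ˣ, (s : ℝ≥0) ≤ 1 →
      ENNReal.ofReal (((s : ℝ≥0) : ℝ) ^ Module.finrank ℚ F) *
        ∑' ξ : F, ENNReal.ofReal (((vecHeight F (![1, (algebraMap F (AdeleRing (𝓞 F) F) ξ + β) * u a *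
          ((posRealIdele F s : (AdeleRing (𝓞 F) F)ˣ) : AdeleRing (𝓞 F) F)] : Fin 2 → AdeleRing (𝓞 F) F) : ℝ≥0) : ℝ) ^
            (-Nexp)) ≤ C₃)
    -- exponents: `m ≥ 4` (rank-one Siegel–Weil: `m = 2N`, `N ≥ 2`) and enough decay
    (hm : 4 ≤ m) (hk : (m : ℝ) * Module.finrank ℚ F < k) :
    ∃ MB : ℝ≥0∞, MB ≠ ⊤ ∧ ∀ β ∈ Kβ, ∀ a ∈ A, ∀ r : ℝ≥0ˣ, (r : ℝ≥0) ≤ 1 → ∀ Φ ∈ 𝔉,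
      (‖E (chirpLM F (β • S) (twistLM F (a * (posRealScalar m F r)⁻¹) Φ))‖ₑ : ℝ≥0∞) ≤
        MB * ENNReal.ofReal (((r : ℝ≥0) : ℝ) ^ ((m : ℝ) * Module.finrank ℚ F / 2)) := by
  set d : ℕ := Module.finrank ℚ F with hd
  -- the theta tail constant
  obtain ⟨BT, hBT, hT⟩ := exists_tsum_enorm_vecMul_tail_ray_le_uniform F (m := m) hM0 hCfc h𝒴 (θ := k) hk le_rfl
  set B₁ : ℝ≥0∞ := BT * ENNReal.ofReal ((max 1 ((m : ℝ) ^ 2 * max H₀ 0)) ^ (k : ℝ)) with hB₁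
  have hB₁top : B₁ ≠ ⊤ := ENNReal.mul_ne_top hBT ENNReal.ofReal_ne_top
  refine ⟨cI * B₁ + κ * (ENNReal.ofReal ((D₀ : ℝ) * A₁) * C₃), ?_, fun β hβ a ha r hr Φ hΦ => ?_⟩
  · exact ENNReal.add_ne_top.2 ⟨ENNReal.mul_ne_top hcI hB₁top,
      ENNReal.mul_ne_top hκ (ENNReal.mul_ne_top ENNReal.ofReal_ne_top hC₃)⟩
  have hr0 : (0 : ℝ) < ((r : ℝ≥0) : ℝ) := NNReal.coe_pos.2 (Units.ne_zero r |>.bot_lt)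
  have hr1 : ((r : ℝ≥0) : ℝ) ≤ 1 := by exact_mod_cast hr
  set g : GL (Fin m) (AdeleRing (𝓞 F) F) := a * (posRealScalar m F r)⁻¹ with hg
  set Φ' : piSchwartzBruhat F (Fin m) := chirpLM F (β • S) (twistLM F g Φ) with hΦ'
  ------------------------------------------------------------------
  -- THETA SIDE: `‖EI Φ'‖ ≤ cI · r^k · B₁`
  ------------------------------------------------------------------
  have hθside : (‖EI Φ'‖ₑ : ℝ≥0∞) ≤ cI * (ENNReal.ofReal (((r : ℝ≥0) : ℝ) ^ (k : ℝ)) * B₁) := by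
    refine hI Φ' _ fun h hh => ?_
    -- the tail of `Φ'` over `L h` is the tail of `Φ` over `(L h * a) z(r)⁻¹`
    have htail : ∑' v : ↥{v : Fin m → F | v ≠ 0},
        (‖(Φ' : (Fin m → AdeleRing (𝓞 F) F) → ℂ) (ratVec F (v : Fin m → F) ᵥ*
          (L h : Matrix (Fin m) (Fin m) (AdeleRing (𝓞 F) F)))‖ₑ : ℝ≥0∞) =
        ∑' v : ↥{v : Fin m → F | v ≠ 0},
          (‖(Φ : (Fin m → AdeleRing (𝓞 F) F) → ℂ) (ratVec F (v : Fin m → F) ᵥ*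
            ((L h * a * (posRealScalar m F r)⁻¹ : GL (Fin m) (AdeleRing (𝓞 F) F)) :
              Matrix (Fin m) (Fin m) (AdeleRing (𝓞 F) F)))‖ₑ : ℝ≥0∞) := by
      refine tsum_congr fun v => ?_
      rw [hΦ', enorm_chirpLM_twistLM_apply, Matrix.vecMul_vecMul, hg, ← Units.val_mul, ← mul_assoc]
    rw [htail]
    obtain ⟨h𝒴a, hHa⟩ := hLA h hh a ha
    refine (hT _ (hdecay Φ hΦ) (hCf Φ hΦ) (L h * a) h𝒴a r).trans ?_
    refine mul_le_mul' le_rfl (mul_le_mul' le_rfl (ENNReal.ofReal_le_ofReal ?_))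
    refine Real.rpow_le_rpow (le_trans zero_le_one (le_max_left _ _)) ?_ (Nat.cast_nonneg k)
    exact max_le_max le_rfl (mul_le_mul_of_nonneg_left (hHa.trans (le_max_left _ _)) (by positivity))
  ------------------------------------------------------------------
  -- EISENSTEIN SIDE: `‖EE Φ'‖ ≤ (D₀ A₁ (r^d)^(m-2)) · C₃`
  ------------------------------------------------------------------
  have hr2le : ((r ^ 2 : ℝ≥0ˣ) : ℝ≥0) ≤ 1 := by
    rw [Units.val_pow_eq_pow_val]
    exact pow_le_one₀ bot_le hr
  have hEside : (‖EE Φ'‖ₑ : ℝ≥0∞) ≤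
      ENNReal.ofReal ((D₀ : ℝ) * A₁ * (((r : ℝ≥0) : ℝ) ^ d) ^ (m - 2)) * C₃ := by
    refine (hEE Φ').trans ?_
    -- the `ξ`-th term
    have hterm : ∀ ξ : F,
        (‖∫ x, chirp F ((algebraMap F (AdeleRing (𝓞 F) F) ξ) • S) ((Φ' : (Fin m → AdeleRing (𝓞 F) F) → ℂ)) x ∂ν‖ₑ :
          ℝ≥0∞) ≤
        ENNReal.ofReal ((D₀ : ℝ) * A₁ * (((r : ℝ≥0) : ℝ) ^ d) ^ m) *
          ENNReal.ofReal (((vecHeight F (![1, (algebraMap F (AdeleRing (𝓞 F) F) ξ + β) * u a *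
            ((posRealIdele F (r ^ 2) : (AdeleRing (𝓞 F) F)ˣ) : AdeleRing (𝓞 F) F)] : Fin 2 → AdeleRing (𝓞 F) F) :
              ℝ≥0) : ℝ) ^ (-Nexp)) := by
      intro ξ
      have hcoe : ((Φ' : (Fin m → AdeleRing (𝓞 F) F) → ℂ)) =
          chirp F (β • S) (twist F g ((Φ : piSchwartzBruhat F (Fin m)) : (Fin m → AdeleRing (𝓞 F) F) → ℂ)) := by
        rw [hΦ', coe_chirpLM, coe_twistLM]
      rw [hcoe, hg, integral_chirp_smul_borelTranslate F ν _ β S a (hsim a ha) r, enorm_smul,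
        Real.enorm_eq_ofReal (NNReal.coe_nonneg _)]
      -- `‖∫…‖ₑ ≤ ofReal (A₁ W)`
      have hW := hE1 Φ hΦ ((algebraMap F (AdeleRing (𝓞 F) F) ξ + β) * u a *
        ((posRealIdele F (r ^ 2) : (AdeleRing (𝓞 F) F)ˣ) : AdeleRing (𝓞 F) F))
      have hI : (‖∫ x, chirp F (((algebraMap F (AdeleRing (𝓞 F) F) ξ + β) * u a *
          ((posRealIdele F (r ^ 2) : (AdeleRing (𝓞 F) F)ˣ) : AdeleRing (𝓞 F) F)) • S)
          ((Φ : piSchwartzBruhat F (Fin m)) : (Fin m → AdeleRing (𝓞 F) F) → ℂ) x ∂ν‖ₑ : ℝ≥0∞) ≤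
          ENNReal.ofReal (A₁ * ((vecHeight F (![1, (algebraMap F (AdeleRing (𝓞 F) F) ξ + β) * u a *
            ((posRealIdele F (r ^ 2) : (AdeleRing (𝓞 F) F)ˣ) : AdeleRing (𝓞 F) F)] : Fin 2 → AdeleRing (𝓞 F) F) :
              ℝ≥0) : ℝ) ^ (-Nexp)) := by
        rw [← ofReal_norm]
        exact ENNReal.ofReal_le_ofReal hW
      -- the scalar: `(r^d)^m |det a|⁻¹ ≤ (r^d)^m D₀`
      have hc : ((((r : ℝ≥0) ^ d) ^ m * (adelicAbsDet m F a)⁻¹ : ℝ≥0) : ℝ) ≤ (((r : ℝ≥0) : ℝ) ^ d) ^ m * (D₀ : ℝ) := by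
        rw [NNReal.coe_mul, NNReal.coe_pow, NNReal.coe_pow]
        exact mul_le_mul_of_nonneg_left (NNReal.coe_le_coe.2 (hdet a ha)) (by positivity)
      calc ENNReal.ofReal ((((r : ℝ≥0) ^ d) ^ m * (adelicAbsDet m F a)⁻¹ : ℝ≥0) : ℝ) *
            (‖∫ x, chirp F (((algebraMap F (AdeleRing (𝓞 F) F) ξ + β) * u a *
              ((posRealIdele F (r ^ 2) : (AdeleRing (𝓞 F) F)ˣ) : AdeleRing (𝓞 F) F)) • S)
              ((Φ : piSchwartzBruhat F (Fin m)) : (Fin m → AdeleRing (𝓞 F) F) → ℂ) x ∂ν‖ₑ : ℝ≥0∞)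
          ≤ ENNReal.ofReal ((((r : ℝ≥0) : ℝ) ^ d) ^ m * (D₀ : ℝ)) *
              ENNReal.ofReal (A₁ * ((vecHeight F (![1, (algebraMap F (AdeleRing (𝓞 F) F) ξ + β) * u a *
                ((posRealIdele F (r ^ 2) : (AdeleRing (𝓞 F) F)ˣ) : AdeleRing (𝓞 F) F)] : Fin 2 → AdeleRing (𝓞 F) F) :
                  ℝ≥0) : ℝ) ^ (-Nexp)) :=
            mul_le_mul' (ENNReal.ofReal_le_ofReal hc) hI
        _ = _ := by
            rw [ENNReal.ofReal_mul hA₁, ← mul_assoc, ← ENNReal.ofReal_mul (by positivity)]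
            congr 2
            ring
    -- sum over `ξ` and use the count at `s = r²`
    calc ∑' ξ : F, (‖∫ x, chirp F ((algebraMap F (AdeleRing (𝓞 F) F) ξ) • S)
            ((Φ' : (Fin m → AdeleRing (𝓞 F) F) → ℂ)) x ∂ν‖ₑ : ℝ≥0∞)
        ≤ ∑' ξ : F, ENNReal.ofReal ((D₀ : ℝ) * A₁ * (((r : ℝ≥0) : ℝ) ^ d) ^ m) *
            ENNReal.ofReal (((vecHeight F (![1, (algebraMap F (AdeleRing (𝓞 F) F) ξ + β) * u a *
              ((posRealIdele F (r ^ 2) : (AdeleRing (𝓞 F) F)ˣ) : AdeleRing (𝓞 F) F)] : Fin 2 → AdeleRing (𝓞 F) F) :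
                ℝ≥0) : ℝ) ^ (-Nexp)) := ENNReal.tsum_le_tsum hterm
      _ = ENNReal.ofReal ((D₀ : ℝ) * A₁ * (((r : ℝ≥0) : ℝ) ^ d) ^ (m - 2)) *
            (ENNReal.ofReal ((((r ^ 2 : ℝ≥0ˣ) : ℝ≥0) : ℝ) ^ Module.finrank ℚ F) *
              ∑' ξ : F, ENNReal.ofReal (((vecHeight F (![1, (algebraMap F (AdeleRing (𝓞 F) F) ξ + β) * u a *
                ((posRealIdele F (r ^ 2) : (AdeleRing (𝓞 F) F)ˣ) : AdeleRing (𝓞 F) F)] : Fin 2 → AdeleRing (𝓞 F) F) :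
                  ℝ≥0) : ℝ) ^ (-Nexp))) := by
          rw [ENNReal.tsum_mul_left, ← mul_assoc, ← ENNReal.ofReal_mul (by positivity)]
          congr 2
          rw [Units.val_pow_eq_pow_val, NNReal.coe_pow, ← hd]
          have hm2 : m = (m - 2) + 2 := (Nat.sub_add_cancel (le_trans (by norm_num) hm)).symm
          conv_lhs => rw [hm2]
          ring
      _ ≤ ENNReal.ofReal ((D₀ : ℝ) * A₁ * (((r : ℝ≥0) : ℝ) ^ d) ^ (m - 2)) * C₃ :=
          mul_le_mul' le_rfl (hE3 β hβ a ha (r ^ 2) hr2le)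
  ------------------------------------------------------------------
  -- COMBINATION: both partial bounds are `≤ const · r^{md/2}` for `r ≤ 1`
  ------------------------------------------------------------------
  have hmd2k : (m : ℝ) * d / 2 ≤ (k : ℝ) := by
    have : (0 : ℝ) ≤ (m : ℝ) * d := by positivity
    linarith
  have hmd2m2 : (m : ℝ) * d / 2 ≤ ((d * (m - 2) : ℕ) : ℝ) := by
    rw [Nat.cast_mul, Nat.cast_sub (le_trans (by norm_num) hm)]
    have hm' : (4 : ℝ) ≤ m := by exact_mod_cast hm
    have hd0 : (0 : ℝ) ≤ d := Nat.cast_nonneg d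
    nlinarith
  have hpow1 : ((r : ℝ≥0) : ℝ) ^ (k : ℝ) ≤ ((r : ℝ≥0) : ℝ) ^ ((m : ℝ) * Module.finrank ℚ F / 2) := by
    rw [← hd]
    exact Real.rpow_le_rpow_of_exponent_ge hr0 hr1 hmd2k
  have hpow2 : (((r : ℝ≥0) : ℝ) ^ d) ^ (m - 2) ≤ ((r : ℝ≥0) : ℝ) ^ ((m : ℝ) * Module.finrank ℚ F / 2) := by
    rw [← pow_mul, ← Real.rpow_natCast, ← hd]
    exact Real.rpow_le_rpow_of_exponent_ge hr0 hr1 hmd2m2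
  calc (‖E Φ'‖ₑ : ℝ≥0∞) ≤ ‖EI Φ'‖ₑ + κ * ‖EE Φ'‖ₑ := hsplit Φ'
    _ ≤ cI * (ENNReal.ofReal (((r : ℝ≥0) : ℝ) ^ (k : ℝ)) * B₁) +
          κ * (ENNReal.ofReal ((D₀ : ℝ) * A₁ * (((r : ℝ≥0) : ℝ) ^ d) ^ (m - 2)) * C₃) :=
        add_le_add hθside (mul_le_mul' le_rfl hEside)
    _ ≤ cI * (ENNReal.ofReal (((r : ℝ≥0) : ℝ) ^ ((m : ℝ) * Module.finrank ℚ F / 2)) * B₁) +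
          κ * (ENNReal.ofReal ((D₀ : ℝ) * A₁ * ((r : ℝ≥0) : ℝ) ^ ((m : ℝ) * Module.finrank ℚ F / 2)) * C₃) := by
        gcongr
    _ = (cI * B₁ + κ * (ENNReal.ofReal ((D₀ : ℝ) * A₁) * C₃)) *
          ENNReal.ofReal (((r : ℝ≥0) : ℝ) ^ ((m : ℝ) * Module.finrank ℚ F / 2)) := by
        rw [ENNReal.ofReal_mul (by positivity : (0 : ℝ) ≤ (D₀ : ℝ) * A₁)]
        ring

end Literature.NumberTheory.Weil1964

end
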